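import Literature.NumberTheory.Sieve.MaynardNFJunk
import HarnessLib

/-!
# The Maynard–Tao sieve over `𝓞_K`: the weights of the `S₂` main term and their junk bound

Topic `Literature/NumberTheory/Sieve`. A. Castillo, C. Hall, R. J. Lemke Oliver, P. Pollack,
L. Thompson, *Bounded gaps between primes in number fields and function fields*, Proc. AMS 143 (2015)
= arXiv:1403.5808, proof of Proposition 2.1 (`S₂` part, via Maynard's Lemma 6.3 over `𝓞_K`).
After Lemma 2.4 (`MaynardNFYm`), the main term `∑_𝔲 κ(𝔲)² M(𝔲)²/∏ g(𝔲ᵢ)` of `S₂^{(m)}` is a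
`(k+1)`-fold sum with the one-dimensional weights `1/φ` (the two slot-`m` variables) and
`w₃ = κ₁²/g = g N²/φ⁴` (the other slots). This file PROVES the elementary facts about these weights
needed for the `(k+1)`-dimensional main-term evaluation (`MaynardNFMainTermC`):

* `cPhi`, `cW3` — the local parameters with `W_{cPhi}(𝔲)/N𝔲 = 1/φ(𝔲)`, `W_{cW3}(𝔲)/N𝔲 = w₃(𝔲)` on
  `G1` (`sieveW_cPhi_div_absNorm`, `sieveW_cW3_div_absNorm`), their bounds `|c_P| ≤ 4/NP`,
  `1 + c_P ≥ 0`;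
* `w3`, `w3_mul_of_coprime`, `w3_prime`, the splitting bounds `inv_idealTotient_le_of_dvd`,
  `w3_le_of_dvd` (`wt(𝔞) ≤ (2/NP) wt(𝔞/P)` for `P ∣ 𝔞`);
* **`sum_prod_bad_pairs_le`** — the junk bound for per-coordinate weights: the tuples of `G1^n`
  in which some prescribed pair of coordinates shares a prime `𝔭 ∤ 𝔴` weigh
  `≤ |Q| (∏ₗ Lₗ) ∑_{𝔭 ∤ 𝔴, N𝔭 ≤ R} 4/N𝔭²`, and `sum_primes_four_div_sq_le` (`≤ 16 D₀^{-1/2} Z₃`).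

## References

* Castillo–Hall–Lemke Oliver–Pollack–Thompson, arXiv:1403.5808, proof of Proposition 2.1.
  [CastilloEtAl2015]
* J. Maynard, *Small gaps between primes*, Ann. of Math. 181 (2015), proof of Lemma 6.3.
  [MaynardAnnals2015]
-/

noncomputable section

open Finset UniqueFactorizationMonoid NumberField IsDedekindDomain
open scoped NumberField Classical

namespace Literature.NumberTheory.Sieve.MaynardNF

open Literature.NumberTheory.LFunctions Literature.NumberTheory.LFunctions.NumberField
  Literature.NumberTheory.Sieve.IdealSieve

variable {K : Type*} [Field K] [NumberField K]
variable {k : ℕ}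

/-! ### Values at primes -/

/-- `φ(𝔭) = N𝔭 − 1` for a prime `𝔭`. [folklore] -/
theorem idealTotient_prime {P : Ideal (𝓞 K)} (hP : Prime P) :
    idealTotient K P = (Ideal.absNorm P : ℝ) - 1 := by
  have h2 : (2 : ℝ) ≤ Ideal.absNorm P := by exact_mod_cast two_le_absNorm_of_prime hP
  rw [idealTotient, normalizedFactors_irreducible hP.irreducible, normalize_eq,
    Multiset.toFinset_singleton, Finset.prod_singleton]
  field_simp

/-- `g(𝔭) = N𝔭 − 2` for a prime `𝔭`. [folklore] -/
theorem gId_prime {P : Ideal (𝓞 K)} (hP : Prime P) : gId K P = (Ideal.absNorm P : ℝ) - 2 := by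
  rw [gId, normalizedFactors_irreducible hP.irreducible, normalize_eq, Multiset.toFinset_singleton,
    Finset.prod_singleton]

/-- On square-free `𝔲`, `N𝔲 = ∏_{P∣𝔲} NP`. [folklore] -/
theorem absNorm_of_squarefree {𝔲 : Ideal (𝓞 K)} (hsq : Squarefree 𝔲) :
    ((Ideal.absNorm 𝔲 : ℕ) : ℝ) = ∏ P ∈ (normalizedFactors 𝔲).toFinset, (Ideal.absNorm P : ℝ) := by
  have h0' : (𝔲 : Ideal (𝓞 K)) ≠ 0 := hsq.ne_zero
  have h0 : 𝔲 ≠ ⊥ := by rwa [Ne, ← Ideal.zero_eq_bot]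
  have hnd := (squarefree_iff_nodup_normalizedFactors h0').1 hsq
  rw [absNorm_eq_prod_pow h0]
  refine Finset.prod_congr rfl fun P hP => ?_
  have h1 : Multiset.count P (normalizedFactors 𝔲) = 1 := by
    have := Multiset.nodup_iff_count_le_one.1 hnd P
    have := Multiset.one_le_count_iff_mem.2 (Multiset.mem_toFinset.1 hP)
    omega
  rw [h1, pow_one]

/-! ### The weight `w₃ = g N²/φ⁴` -/

variable (K) in
/-- `w₃(𝔲) = g(𝔲) N𝔲²/φ(𝔲)⁴ = κ₁(𝔲)²/g(𝔲)` (`κ₁ = g N/φ²`), the one-dimensional weight of the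
non-`m` slots in the `S₂` main term. [cite: MaynardAnnals2015, proof of Lemma 6.3] -/
def w3 (𝔲 : Ideal (𝓞 K)) : ℝ := gId K 𝔲 * (Ideal.absNorm 𝔲 : ℝ) ^ 2 / idealTotient K 𝔲 ^ 4

/-- `w₃` is multiplicative on comaximal ideals. [folklore] -/
theorem w3_mul_of_coprime {𝔞 𝔟 : Ideal (𝓞 K)} (h : 𝔞 ⊔ 𝔟 = ⊤) : w3 K (𝔞 * 𝔟) = w3 K 𝔞 * w3 K 𝔟 := by
  rw [w3, w3, w3, gId_mul_of_coprime 𝔞 𝔟 h, idealTotient_mul_of_coprime 𝔞 𝔟 h, map_mul]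
  push_cast
  ring

/-- `w₃(𝔭) = (N𝔭 − 2)N𝔭²/(N𝔭 − 1)⁴`. [folklore] -/
theorem w3_prime {P : Ideal (𝓞 K)} (hP : Prime P) :
    w3 K P = ((Ideal.absNorm P : ℝ) - 2) * (Ideal.absNorm P : ℝ) ^ 2 / ((Ideal.absNorm P : ℝ) - 1) ^ 4 := by
  rw [w3, gId_prime hP, idealTotient_prime hP]

/-- `w₃(𝔭) ≤ 2/N𝔭` (`N𝔭 ≥ 2`). [folklore] -/
theorem w3_prime_le {P : Ideal (𝓞 K)} (hP : Prime P) : w3 K P ≤ 2 / (Ideal.absNorm P : ℝ) := by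
  have h2 : (2 : ℝ) ≤ Ideal.absNorm P := by exact_mod_cast two_le_absNorm_of_prime hP
  have h1 : (0 : ℝ) < ((Ideal.absNorm P : ℝ) - 1) ^ 4 := by
    have : (0 : ℝ) < (Ideal.absNorm P : ℝ) - 1 := by linarith
    positivity
  rw [w3_prime hP, div_le_div_iff₀ h1 (by positivity)]
  nlinarith [sq_nonneg ((Ideal.absNorm P : ℝ) - 2), sq_nonneg ((Ideal.absNorm P : ℝ) - 1),
    mul_nonneg (sub_nonneg.2 h2) (sq_nonneg ((Ideal.absNorm P : ℝ) - 1))]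

/-- `w₃ ≥ 0` on `G1` when the primes of norm `2` divide `𝔴`. [folklore] -/
theorem w3_nonneg_of_mem_G1 {𝔴 : Ideal (𝓞 K)} {B : ℝ}
    (h2 : ∀ P : Ideal (𝓞 K), Prime P → Ideal.absNorm P = 2 → P ∣ 𝔴) {𝔫 : Ideal (𝓞 K)}
    (hn : 𝔫 ∈ G1 K 𝔴 B) : 0 ≤ w3 K 𝔫 :=
  div_nonneg (mul_nonneg (gId_pos_of_mem_G1 h2 hn).le (sq_nonneg _)) (pow_nonneg (idealTotient_pos_of_mem_G1 hn).le 4)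

/-- **Splitting a prime off `1/φ`**: for `𝔭 ∣ 𝔞`, `𝔞` squarefree, `1/φ(𝔞) ≤ (2/N𝔭) · 1/φ(𝔞/𝔭)`. [folklore] -/
theorem inv_idealTotient_le_of_dvd {P 𝔞 : Ideal (𝓞 K)} (hP : Prime P) (hsq : Squarefree 𝔞) (hPa : P ∣ 𝔞) :
    1 / idealTotient K 𝔞 ≤ 2 / (Ideal.absNorm P : ℝ) * (1 / idealTotient K (cof P 𝔞)) := by
  have heq := eq_mul_cof hPa
  have hcop : P ⊔ cof P 𝔞 = ⊤ := sup_eq_top_of_squarefree_mul (heq ▸ hsq)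
  have hc0 : cof P 𝔞 ≠ ⊥ := by
    intro h
    rw [h, Ideal.mul_bot] at heq
    exact hsq.ne_zero (heq.trans Ideal.zero_eq_bot.symm)
  have h2 : (2 : ℝ) ≤ Ideal.absNorm P := by exact_mod_cast two_le_absNorm_of_prime hP
  have hφc := idealTotient_pos hc0 (K := K)
  conv_lhs => rw [heq]
  rw [idealTotient_mul_of_coprime _ _ hcop, idealTotient_prime hP, div_mul_div_comm, mul_one,
    div_le_div_iff₀ (mul_pos (by linarith) hφc) (by positivity)]
  nlinarith

/-- **Splitting a prime off `w₃`**: for `𝔭 ∣ 𝔞`, `𝔞` squarefree, `w₃(𝔞) ≤ (2/N𝔭) w₃(𝔞/𝔭)`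
(when `w₃(𝔞/𝔭) ≥ 0`). [folklore] -/
theorem w3_le_of_dvd {P 𝔞 : Ideal (𝓞 K)} (hP : Prime P) (hsq : Squarefree 𝔞) (hPa : P ∣ 𝔞)
    (h0 : 0 ≤ w3 K (cof P 𝔞)) :
    w3 K 𝔞 ≤ 2 / (Ideal.absNorm P : ℝ) * w3 K (cof P 𝔞) := by
  have heq := eq_mul_cof hPa
  have hcop : P ⊔ cof P 𝔞 = ⊤ := sup_eq_top_of_squarefree_mul (heq ▸ hsq)
  conv_lhs => rw [heq]
  rw [w3_mul_of_coprime hcop]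
  exact mul_le_mul_of_nonneg_right (w3_prime_le hP) h0

/-! ### The weights as `W_c/N` -/

/-- The local parameter of `1/φ`: `c_𝔭 = 1/(N𝔭 − 1)`. [folklore] -/
def cPhi (P : Ideal (𝓞 K)) : ℝ := 1 / ((Ideal.absNorm P : ℝ) - 1)

/-- The local parameter of `w₃`: `1 + c_𝔭 = (N𝔭 − 2)N𝔭³/(N𝔭 − 1)⁴`. [folklore] -/
def cW3 (P : Ideal (𝓞 K)) : ℝ :=
  ((Ideal.absNorm P : ℝ) - 2) * (Ideal.absNorm P : ℝ) ^ 3 / ((Ideal.absNorm P : ℝ) - 1) ^ 4 - 1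

/-- `|cPhi 𝔭| ≤ 4/N𝔭`. [folklore] -/
theorem abs_cPhi_le {P : Ideal (𝓞 K)} (hP : Prime P) : |cPhi P| ≤ 4 / (Ideal.absNorm P : ℝ) := by
  have h2 : (2 : ℝ) ≤ Ideal.absNorm P := by exact_mod_cast two_le_absNorm_of_prime hP
  rw [cPhi, abs_of_pos (one_div_pos.2 (by linarith)), div_le_div_iff₀ (by linarith) (by linarith)]
  linarith

/-- `1 + cPhi 𝔭 ≥ 0`. [folklore] -/
theorem one_add_cPhi_nonneg {P : Ideal (𝓞 K)} (hP : Prime P) : 0 ≤ 1 + cPhi P := by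
  have h2 : (2 : ℝ) ≤ Ideal.absNorm P := by exact_mod_cast two_le_absNorm_of_prime hP
  have : 0 ≤ cPhi P := (one_div_pos.2 (by linarith)).le
  linarith

/-- `|cW3 𝔭| ≤ 4/N𝔭`. [folklore] -/
theorem abs_cW3_le {P : Ideal (𝓞 K)} (hP : Prime P) : |cW3 P| ≤ 4 / (Ideal.absNorm P : ℝ) := by
  have h2 : (2 : ℝ) ≤ Ideal.absNorm P := by exact_mod_cast two_le_absNorm_of_prime hP
  set x : ℝ := (Ideal.absNorm P : ℝ) with hx
  have hx1' : 0 < x - 1 := by linarith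
  have hx1 : 0 < (x - 1) ^ 4 := by positivity
  have hx0 : 0 < x := by linarith
  have heq : cW3 P = (2 * x ^ 3 - 6 * x ^ 2 + 4 * x - 1) / (x - 1) ^ 4 := by
    rw [cW3, ← hx, div_sub_one hx1.ne', div_left_inj' hx1.ne']
    ring
  rw [heq, abs_div, abs_of_pos hx1, div_le_div_iff₀ hx1 hx0]
  have e : |2 * x ^ 3 - 6 * x ^ 2 + 4 * x - 1| * x = |(2 * x ^ 3 - 6 * x ^ 2 + 4 * x - 1) * x| := by
    rw [abs_mul, abs_of_pos hx0]
  rw [e, abs_le]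
  constructor
  · nlinarith [sq_nonneg (x - 2), sq_nonneg (x - 1), mul_nonneg (sub_nonneg.2 h2) (sq_nonneg (x - 1)),
      mul_nonneg (mul_nonneg (sub_nonneg.2 h2) (sub_nonneg.2 h2)) (sq_nonneg (x - 1))]
  · nlinarith [sq_nonneg (x - 2), sq_nonneg (x - 1), mul_nonneg (sub_nonneg.2 h2) (sq_nonneg (x - 1)),
      mul_nonneg (mul_nonneg (sub_nonneg.2 h2) (sub_nonneg.2 h2)) (sq_nonneg (x - 1))]

/-- `1 + cW3 𝔭 ≥ 0`. [folklore] -/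
theorem one_add_cW3_nonneg {P : Ideal (𝓞 K)} (hP : Prime P) : 0 ≤ 1 + cW3 P := by
  have h2 : (2 : ℝ) ≤ Ideal.absNorm P := by exact_mod_cast two_le_absNorm_of_prime hP
  rw [cW3, add_sub_cancel]
  exact div_nonneg (mul_nonneg (by linarith) (by positivity)) (by positivity)

/-- **`W_{cPhi}(𝔲)/N𝔲 = 1/φ(𝔲)` on `G1`**. [folklore] -/
theorem sieveW_cPhi_div_absNorm {𝔴 : Ideal (𝓞 K)} {B : ℝ} {𝔲 : Ideal (𝓞 K)} (hu : 𝔲 ∈ G1 K 𝔴 B) :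
    sieveW 𝔴 cPhi 𝔲 / ((Ideal.absNorm 𝔲 : ℕ) : ℝ) = 1 / idealTotient K 𝔲 := by
  obtain ⟨⟨h0, -⟩, hsq, hcop⟩ := mem_G1.1 hu
  have h := sieveW_totient_div_absNorm (𝔴 := 𝔴) h0
  rw [if_pos ⟨hcop, hsq⟩] at h
  change sieveW 𝔴 (fun P => 1 / ((Ideal.absNorm P : ℝ) - 1)) 𝔲 / ((Ideal.absNorm 𝔲 : ℕ) : ℝ) = _
  rw [h, idealTotient_of_squarefree hsq, one_div, ← Finset.prod_inv_distrib]
  exact Finset.prod_congr rfl fun P _ => one_div _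

/-- **`W_{cW3}(𝔲)/N𝔲 = w₃(𝔲)` on `G1`**. [folklore] -/
theorem sieveW_cW3_div_absNorm {𝔴 : Ideal (𝓞 K)} {B : ℝ} {𝔲 : Ideal (𝓞 K)} (hu : 𝔲 ∈ G1 K 𝔴 B) :
    sieveW 𝔴 cW3 𝔲 / ((Ideal.absNorm 𝔲 : ℕ) : ℝ) = w3 K 𝔲 := by
  obtain ⟨⟨h0, -⟩, hsq, hcop⟩ := mem_G1.1 hu
  rw [sieveW, if_pos ⟨hcop, hsq⟩, w3, gId, idealTotient_of_squarefree hsq, absNorm_of_squarefree hsq,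
    ← Finset.prod_pow, ← Finset.prod_pow, ← Finset.prod_mul_distrib, ← Finset.prod_div_distrib,
    ← Finset.prod_div_distrib]
  refine Finset.prod_congr rfl fun P hP => ?_
  have h2 : (2 : ℝ) ≤ Ideal.absNorm P := by
    exact_mod_cast two_le_absNorm_of_prime (prime_of_normalized_factor P (Multiset.mem_toFinset.1 hP))
  have hN1 : (Ideal.absNorm P : ℝ) - 1 ≠ 0 := by linarith
  have hN0 : (Ideal.absNorm P : ℝ) ≠ 0 := by linarith
  rw [cW3]
  field_simp
  ring

/-! ### The junk bound for per-coordinate weights -/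

/-- The `G1`-sum of a weight through a fixed prime: if `wt(𝔞) ≤ (2/N𝔭) wt(𝔞/𝔭)` for `𝔭 ∣ 𝔞 ∈ G1`
and `wt ≥ 0` on `G1`, then `∑_{𝔞 ∈ G1, 𝔭 ∣ 𝔞} wt(𝔞) ≤ (2/N𝔭) ∑_{𝔞 ∈ G1} wt(𝔞)`. [folklore] -/
theorem sum_G1_filter_dvd_wt_le {𝔴 : Ideal (𝓞 K)} {B : ℝ} {wt : Ideal (𝓞 K) → ℝ}
    (hwt0 : ∀ 𝔞 ∈ G1 K 𝔴 B, 0 ≤ wt 𝔞) {P : Ideal (𝓞 K)}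
    (hwtP : ∀ 𝔞 ∈ G1 K 𝔴 B, P ∣ 𝔞 → wt 𝔞 ≤ 2 / (Ideal.absNorm P : ℝ) * wt (cof P 𝔞)) :
    ∑ 𝔞 ∈ (G1 K 𝔴 B).filter (fun 𝔞 => P ∣ 𝔞), wt 𝔞 ≤
      2 / (Ideal.absNorm P : ℝ) * ∑ 𝔞 ∈ G1 K 𝔴 B, wt 𝔞 := by
  have hinj : Set.InjOn (cof P) ((G1 K 𝔴 B).filter (fun 𝔞 => P ∣ 𝔞) : Set (Ideal (𝓞 K))) := by
    intro 𝔞 ha 𝔞' ha' h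
    rw [Finset.mem_coe, Finset.mem_filter] at ha ha'
    rw [eq_mul_cof ha.2, eq_mul_cof ha'.2, h]
  calc ∑ 𝔞 ∈ (G1 K 𝔴 B).filter (fun 𝔞 => P ∣ 𝔞), wt 𝔞
      ≤ ∑ 𝔞 ∈ (G1 K 𝔴 B).filter (fun 𝔞 => P ∣ 𝔞), 2 / (Ideal.absNorm P : ℝ) * wt (cof P 𝔞) :=
        Finset.sum_le_sum fun 𝔞 ha => hwtP 𝔞 (Finset.mem_filter.1 ha).1 (Finset.mem_filter.1 ha).2
    _ = 2 / (Ideal.absNorm P : ℝ) * ∑ 𝔞' ∈ ((G1 K 𝔴 B).filter (fun 𝔞 => P ∣ 𝔞)).image (cof P), wt 𝔞' := by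
        rw [Finset.mul_sum, Finset.sum_image hinj]
    _ ≤ 2 / (Ideal.absNorm P : ℝ) * ∑ 𝔞 ∈ G1 K 𝔴 B, wt 𝔞 := by
        refine mul_le_mul_of_nonneg_left ?_ (by positivity)
        refine Finset.sum_le_sum_of_subset_of_nonneg (fun 𝔞' ha' => ?_) fun 𝔞 ha _ => hwt0 𝔞 ha
        rw [Finset.mem_image] at ha'
        obtain ⟨𝔞, ha, rfl⟩ := ha'
        rw [Finset.mem_filter] at ha
        exact mem_G1_of_dvd ha.1 ⟨P, by rw [mul_comm]; exact eq_mul_cof ha.2⟩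

/-- **The tuples through a fixed prime in two prescribed coordinates** weigh `≤ (2/N𝔭)² ∏ₗ Lₗ`,
`Lₗ = ∑_{G1} wtₗ`. [cite: MaynardAnnals2015, proof of Lemma 6.2, (6.5)] -/
theorem sum_prod_wt_filter_dvd_le {n : ℕ} {𝔴 : Ideal (𝓞 K)} {B : ℝ} {wt : Fin n → Ideal (𝓞 K) → ℝ}
    (hwt0 : ∀ l, ∀ 𝔞 ∈ G1 K 𝔴 B, 0 ≤ wt l 𝔞) {P : Ideal (𝓞 K)}
    (hwtP : ∀ l, ∀ 𝔞 ∈ G1 K 𝔴 B, P ∣ 𝔞 → wt l 𝔞 ≤ 2 / (Ideal.absNorm P : ℝ) * wt l (cof P 𝔞))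
    {i j : Fin n} (hij : i ≠ j) :
    ∑ 𝔲 ∈ (Fintype.piFinset fun _ : Fin n => G1 K 𝔴 B).filter (fun 𝔲 => P ∣ 𝔲 i ∧ P ∣ 𝔲 j),
        ∏ l, wt l (𝔲 l) ≤
      (2 / (Ideal.absNorm P : ℝ)) ^ 2 * ∏ l, ∑ 𝔞 ∈ G1 K 𝔴 B, wt l 𝔞 := by
  classical
  have hq0 : 0 ≤ 2 / (Ideal.absNorm P : ℝ) := by positivity
  have hL0 : ∀ l, 0 ≤ ∑ 𝔞 ∈ G1 K 𝔴 B, wt l 𝔞 := fun l => Finset.sum_nonneg (hwt0 l)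
  have hLp : ∀ l, ∑ 𝔞 ∈ (G1 K 𝔴 B).filter (fun 𝔞 => P ∣ 𝔞), wt l 𝔞 ≤
      2 / (Ideal.absNorm P : ℝ) * ∑ 𝔞 ∈ G1 K 𝔴 B, wt l 𝔞 := fun l =>
    sum_G1_filter_dvd_wt_le (hwt0 l) (hwtP l)
  have hLp0 : ∀ l, 0 ≤ ∑ 𝔞 ∈ (G1 K 𝔴 B).filter (fun 𝔞 => P ∣ 𝔞), wt l 𝔞 := fun l =>
    Finset.sum_nonneg fun 𝔞 ha => hwt0 l 𝔞 (Finset.mem_filter.1 ha).1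
  -- the filtered box is a product box
  set T : Fin n → Finset (Ideal (𝓞 K)) := fun l =>
    if l = i ∨ l = j then (G1 K 𝔴 B).filter (fun 𝔞 => P ∣ 𝔞) else G1 K 𝔴 B with hT
  have hset : (Fintype.piFinset fun _ : Fin n => G1 K 𝔴 B).filter (fun 𝔲 => P ∣ 𝔲 i ∧ P ∣ 𝔲 j) =
      Fintype.piFinset T := by
    ext 𝔲
    simp only [Finset.mem_filter, Fintype.mem_piFinset, hT]
    constructor
    · rintro ⟨h, hi, hj⟩ l
      by_cases hl : l = i ∨ l = j
      · rw [if_pos hl, Finset.mem_filter]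
        rcases hl with rfl | rfl
        · exact ⟨h l, hi⟩
        · exact ⟨h l, hj⟩
      · rw [if_neg hl]; exact h l
    · intro h
      have hmem : ∀ l, 𝔲 l ∈ G1 K 𝔴 B := fun l => by
        have := h l
        by_cases hl : l = i ∨ l = j
        · rw [if_pos hl, Finset.mem_filter] at this; exact this.1
        · rwa [if_neg hl] at this
      have hi := h i
      have hj := h j
      rw [if_pos (Or.inl rfl), Finset.mem_filter] at hi
      rw [if_pos (Or.inr rfl), Finset.mem_filter] at hj
      exact ⟨hmem, hi.2, hj.2⟩
  rw [hset, ← Finset.prod_univ_sum T (fun l 𝔞 => wt l 𝔞)]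
  -- bound the factors
  have hfac : ∀ l, ∑ 𝔞 ∈ T l, wt l 𝔞 ≤ (if l = i ∨ l = j then 2 / (Ideal.absNorm P : ℝ) else 1) *
      ∑ 𝔞 ∈ G1 K 𝔴 B, wt l 𝔞 := by
    intro l
    by_cases hl : l = i ∨ l = j
    · simp only [hT, if_pos hl]; exact hLp l
    · simp only [hT, if_neg hl, one_mul]; exact le_rfl
  have hfac0 : ∀ l, 0 ≤ ∑ 𝔞 ∈ T l, wt l 𝔞 := by
    intro l
    by_cases hl : l = i ∨ l = j
    · simp only [hT, if_pos hl]; exact hLp0 l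
    · simp only [hT, if_neg hl]; exact hL0 l
  calc ∏ l, ∑ 𝔞 ∈ T l, wt l 𝔞 ≤ ∏ l, ((if l = i ∨ l = j then 2 / (Ideal.absNorm P : ℝ) else 1) *
        ∑ 𝔞 ∈ G1 K 𝔴 B, wt l 𝔞) := Finset.prod_le_prod (fun l _ => hfac0 l) fun l _ => hfac l
    _ = (∏ l, (if l = i ∨ l = j then 2 / (Ideal.absNorm P : ℝ) else 1)) * ∏ l, ∑ 𝔞 ∈ G1 K 𝔴 B, wt l 𝔞 :=
        Finset.prod_mul_distrib
    _ = (2 / (Ideal.absNorm P : ℝ)) ^ 2 * ∏ l, ∑ 𝔞 ∈ G1 K 𝔴 B, wt l 𝔞 := by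
        congr 1
        rw [Finset.prod_ite, Finset.prod_const_one, mul_one, Finset.prod_const]
        congr 1
        have : (Finset.univ.filter fun l : Fin n => l = i ∨ l = j) = {i, j} := by
          ext l; simp [Finset.mem_insert, Finset.mem_singleton]
        rw [this, Finset.card_pair hij]

/-- **The junk bound**: for a set `Q` of off-diagonal coordinate pairs, the tuples of `G1^n` with
some pair in `Q` sharing a prime `𝔭 ∤ 𝔴` of norm `≤ R` weigh
`≤ |Q| (∏ₗ Lₗ) ∑_{𝔭 ∤ 𝔴, N𝔭 ≤ R} 4/N𝔭²`. [cite: MaynardAnnals2015, proof of Lemma 6.3 (the terms with a common prime factor)] -/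
theorem sum_prod_bad_pairs_le {n : ℕ} {𝔴 : Ideal (𝓞 K)} {B R : ℝ} {wt : Fin n → Ideal (𝓞 K) → ℝ}
    (hwt0 : ∀ l, ∀ 𝔞 ∈ G1 K 𝔴 B, 0 ≤ wt l 𝔞)
    (hwtP : ∀ l, ∀ P : Ideal (𝓞 K), Prime P → ¬ P ∣ 𝔴 → ∀ 𝔞 ∈ G1 K 𝔴 B, P ∣ 𝔞 →
      wt l 𝔞 ≤ 2 / (Ideal.absNorm P : ℝ) * wt l (cof P 𝔞))
    (Q : Finset (Fin n × Fin n)) (hQ : ∀ q ∈ Q, q.1 ≠ q.2) :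
    ∑ 𝔲 ∈ (Fintype.piFinset fun _ : Fin n => G1 K 𝔴 B).filter (fun 𝔲 =>
        ∃ q ∈ Q, ∃ P ∈ ((finite_primeIdealsLE K R).toFinset).filter (fun P => ¬ P ∣ 𝔴),
          P ∣ 𝔲 q.1 ∧ P ∣ 𝔲 q.2), ∏ l, wt l (𝔲 l) ≤
      Q.card * (∏ l, ∑ 𝔞 ∈ G1 K 𝔴 B, wt l 𝔞) *
        ∑ P ∈ ((finite_primeIdealsLE K R).toFinset).filter (fun P => ¬ P ∣ 𝔴),
          4 / (Ideal.absNorm P : ℝ) ^ 2 := by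
  classical
  set TP := ((finite_primeIdealsLE K R).toFinset).filter (fun P => ¬ P ∣ 𝔴) with hTP
  have hTPprime : ∀ P ∈ TP, Prime P ∧ ¬ P ∣ 𝔴 := fun P hP => by
    have h := Finset.mem_filter.1 hP
    rw [Set.Finite.mem_toFinset] at h
    exact ⟨Ideal.prime_of_isPrime h.1.2.1 h.1.1, h.2⟩
  have hw0 : ∀ 𝔲 ∈ (Fintype.piFinset fun _ : Fin n => G1 K 𝔴 B), 0 ≤ ∏ l, wt l (𝔲 l) :=
    fun 𝔲 hu => Finset.prod_nonneg fun l _ => hwt0 l _ (Fintype.mem_piFinset.1 hu l)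
  have hL0 : 0 ≤ ∏ l, ∑ 𝔞 ∈ G1 K 𝔴 B, wt l 𝔞 := Finset.prod_nonneg fun l _ => Finset.sum_nonneg (hwt0 l)
  set QP : Finset ((Fin n × Fin n) × Ideal (𝓞 K)) := Q ×ˢ TP with hQP
  set C : ((Fin n × Fin n) × Ideal (𝓞 K)) → (Fin n → Ideal (𝓞 K)) → Prop :=
    fun q 𝔲 => q.2 ∣ 𝔲 q.1.1 ∧ q.2 ∣ 𝔲 q.1.2 with hC
  have step1 : ∑ 𝔲 ∈ (Fintype.piFinset fun _ : Fin n => G1 K 𝔴 B).filter (fun 𝔲 =>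
        ∃ q ∈ Q, ∃ P ∈ TP, P ∣ 𝔲 q.1 ∧ P ∣ 𝔲 q.2), ∏ l, wt l (𝔲 l) =
      ∑ 𝔲 ∈ (Fintype.piFinset fun _ : Fin n => G1 K 𝔴 B).filter (fun 𝔲 => ∃ qP ∈ QP, C qP 𝔲),
        ∏ l, wt l (𝔲 l) := by
    refine Finset.sum_congr (Finset.filter_congr fun 𝔲 _ => ?_) fun _ _ => rfl
    simp only [hQP, hC, Finset.mem_product]
    constructor
    · rintro ⟨q, hq, P, hP, h⟩; exact ⟨(q, P), ⟨hq, hP⟩, h⟩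
    · rintro ⟨qP, ⟨hq, hP⟩, h⟩; exact ⟨qP.1, hq, qP.2, hP, h⟩
  rw [step1]
  refine (MaynardSieve.sum_filter_exists_le QP _ C _ hw0).trans ?_
  have step3 : ∀ qP ∈ QP, ∑ 𝔲 ∈ (Fintype.piFinset fun _ : Fin n => G1 K 𝔴 B).filter (C qP),
      ∏ l, wt l (𝔲 l) ≤ (2 / (Ideal.absNorm qP.2 : ℝ)) ^ 2 * ∏ l, ∑ 𝔞 ∈ G1 K 𝔴 B, wt l 𝔞 := by
    intro qP hqP
    rw [hQP, Finset.mem_product] at hqP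
    obtain ⟨hPp, hPw⟩ := hTPprime qP.2 hqP.2
    exact sum_prod_wt_filter_dvd_le hwt0 (fun l 𝔞 ha hd => hwtP l qP.2 hPp hPw 𝔞 ha hd) (hQ qP.1 hqP.1)
  refine (Finset.sum_le_sum step3).trans (le_of_eq ?_)
  have hpt : ∀ P ∈ TP, (2 / (Ideal.absNorm P : ℝ)) ^ 2 * ∏ l, ∑ 𝔞 ∈ G1 K 𝔴 B, wt l 𝔞 =
      (∏ l, ∑ 𝔞 ∈ G1 K 𝔴 B, wt l 𝔞) * (4 / (Ideal.absNorm P : ℝ) ^ 2) := fun P _ => by ring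
  rw [hQP, Finset.sum_product]
  simp only [Finset.sum_const]
  rw [Finset.sum_congr rfl hpt, ← Finset.mul_sum, nsmul_eq_mul, ← mul_assoc]

/-- **The prime tail**: `∑_{𝔭 ∤ 𝔴, N𝔭 ≤ R} 4/N𝔭² ≤ 16 D₀^{-1/2} ∑_𝔭 N𝔭^{-3/2}` when every prime of norm
`≤ D₀` divides `𝔴` (`D₀ ≥ 1`). [cite: MaynardAnnals2015, proof of Lemma 6.2, (6.5)] -/
theorem sum_primes_four_div_sq_le {𝔴 : Ideal (𝓞 K)} {D₀ : ℝ} (hD₀ : 1 ≤ D₀)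
    (hD : ∀ P : Ideal (𝓞 K), Prime P → (Ideal.absNorm P : ℝ) ≤ D₀ → P ∣ 𝔴) (R : ℝ) :
    ∑ P ∈ ((finite_primeIdealsLE K R).toFinset).filter (fun P => ¬ P ∣ 𝔴), 4 / (Ideal.absNorm P : ℝ) ^ 2 ≤
      16 * D₀ ^ (-(1 : ℝ) / 2) *
        ∑' v : HeightOneSpectrum (𝓞 K), (Ideal.absNorm v.asIdeal : ℝ) ^ (-(3 : ℝ) / 2) := by
  have hZsum : Summable fun v : HeightOneSpectrum (𝓞 K) =>
      (Ideal.absNorm v.asIdeal : ℝ) ^ (-(3 : ℝ) / 2) := by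
    have := summable_absNorm_rpow_neg (K := K) (s := 3 / 2) (by norm_num)
    refine this.congr fun v => ?_
    norm_num
  have hpt : ∀ P ∈ ((finite_primeIdealsLE K R).toFinset).filter (fun P => ¬ P ∣ 𝔴),
      4 / (Ideal.absNorm P : ℝ) ^ 2 ≤ 16 * D₀ ^ (-(1 : ℝ) / 2) * (Ideal.absNorm P : ℝ) ^ (-(3 : ℝ) / 2) := by
    intro P hP
    rw [Finset.mem_filter] at hP
    have hmem := hP.1
    rw [Set.Finite.mem_toFinset] at hmem
    have hPprime : Prime P := Ideal.prime_of_isPrime hmem.2.1 hmem.1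
    have h2 : (2 : ℝ) ≤ Ideal.absNorm P := by exact_mod_cast two_le_absNorm_of_prime hPprime
    have hDP : D₀ < Ideal.absNorm P := lt_of_not_ge fun h => hP.2 (hD P hPprime h)
    have hNP0 : (0 : ℝ) < Ideal.absNorm P := by linarith
    have h1 : (4 : ℝ) / (Ideal.absNorm P : ℝ) ^ 2 =
        4 * ((Ideal.absNorm P : ℝ) ^ (-(1 : ℝ) / 2) * (Ideal.absNorm P : ℝ) ^ (-(3 : ℝ) / 2)) := by
      rw [← Real.rpow_add hNP0, show (-(1 : ℝ) / 2 + -(3 : ℝ) / 2) = -((2 : ℕ) : ℝ) by norm_num,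
        Real.rpow_neg hNP0.le, Real.rpow_natCast, div_eq_mul_inv]
    have h3 : (Ideal.absNorm P : ℝ) ^ (-(1 : ℝ) / 2) ≤ D₀ ^ (-(1 : ℝ) / 2) :=
      Real.rpow_le_rpow_of_nonpos (by linarith) hDP.le (by norm_num)
    rw [h1]
    calc 4 * ((Ideal.absNorm P : ℝ) ^ (-(1 : ℝ) / 2) * (Ideal.absNorm P : ℝ) ^ (-(3 : ℝ) / 2))
        ≤ 4 * (D₀ ^ (-(1 : ℝ) / 2) * (Ideal.absNorm P : ℝ) ^ (-(3 : ℝ) / 2)) := by gcongr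
      _ ≤ 16 * (D₀ ^ (-(1 : ℝ) / 2) * (Ideal.absNorm P : ℝ) ^ (-(3 : ℝ) / 2)) := by
          have : 0 ≤ D₀ ^ (-(1 : ℝ) / 2) * (Ideal.absNorm P : ℝ) ^ (-(3 : ℝ) / 2) := by positivity
          nlinarith
      _ = _ := by ring
  refine (Finset.sum_le_sum hpt).trans ?_
  rw [← Finset.mul_sum]
  refine mul_le_mul_of_nonneg_left ?_ (by positivity)
  calc ∑ P ∈ ((finite_primeIdealsLE K R).toFinset).filter (fun P => ¬ P ∣ 𝔴),
        (Ideal.absNorm P : ℝ) ^ (-(3 : ℝ) / 2)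
      ≤ ∑ P ∈ (finite_primeIdealsLE K R).toFinset, (Ideal.absNorm P : ℝ) ^ (-(3 : ℝ) / 2) :=
        Finset.sum_le_sum_of_subset_of_nonneg (Finset.filter_subset _ _) fun _ _ _ => by positivity
    _ ≤ _ := sum_primeIdealsLE_le_tsum (g := fun P => (Ideal.absNorm P : ℝ) ^ (-(3 : ℝ) / 2))
        (fun P => by positivity) hZsum R

end Literature.NumberTheory.Sieve.MaynardNF
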